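import Summits.QuantumAdvantage.QuantumAdvantage.Theorems.CubicForrelationNearExactIsExactEightLevelFour

/-!
# Crux `CubicForrelation.NearExactIsExact` (stmt-QuantumAdvantage-14043) — a quadratic with `2¹²` ones on 14 bits is a 12-FLAT

Certificate seat `b2b-cforr-cert` (gen 4).  HONEST FRAMING: an elementary lemma about quadratic Boolean functions on 14 bits, input to the
two-sided exclusion of the boundary value `Φ = 31/32` on the finite slice `n = 14` of the crux — NOT summit progress.

`qf_flat_of_quadratic`: if `q : 𝔽₂¹⁴ → 𝔽₂` has algebraic degree `≤ 2` and exactly `4096 = 2^{14−2}` ones (the minimum weight of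
`RM(2,14)`), then its set of periods `V₀ = {a : q(x ⊕ a) = q(x) ∀ x}` is `⊕`-closed of size `4096` and the ones of `q` form ONE coset
`x₀ ⊕ V₀` (a 12-flat).  This is the landed 8-bit lemma `el_flat_of_quadratic` (`64` ones ⇒ 6-flat) with the constants scaled: every
derivative `q ⊕ q(· ⊕ a)` is affine (`stub_derivDegree`), hence has `0` or `8192` ones (`16384` is impossible next to `4096` ones of `q`);
double counting `Σ_a #{q ≠ q(·⊕a)} = 2·4096·12288` gives exactly `12288` non-periods, so `4096` periods; `q` is constant on `V₀`-cosets and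
has as many ones as `|V₀|`.  In the level-6 analysis at `n = 14` the quadratic parity `[W_g/64 odd]` has exactly `2¹²` ones at the
boundary `Φ = 31/32`, so the odd Walsh values sit on a 12-flat.

References: F. J. MacWilliams, N. J. A. Sloane, *The Theory of Error-Correcting Codes* (1977), Ch. 13 and Ch. 15; C. Carlet, *Boolean
Functions for Cryptography and Coding Theory*, CUP 2021, §4.1, §5.2.  Everything below is proved from Mathlib and the tree; axioms are the
standard three.
-/

set_option linter.dupNamespace false -- D-0017: single-problem summit ⇒ `QuantumAdvantage.QuantumAdvantage` by design

noncomputable section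

namespace Summit.QuantumAdvantage.QuantumAdvantage.Theorems.CubicForrelation.NearExactIsExact

open Finset
open Literature.Computability.QuantumComplexity
open Literature.Computability.QuantumComplexity.BuzetChailloux (bxor zeroVec bxor_bxor_cancel_left twist_zeroVec_right bxor_zeroVec
  zeroVec_bxor signOf_sq)
open Literature.Computability.QuantumComplexity.DerivativeWalsh (W)

/-! ### A quadratic with `4096` ones on 14 bits is the indicator of a 12-flat -/

/-- The number of ones of an affine Boolean function on 14 bits is `0`, `8192` or `16384`. [cite: Carlet2020, §4.1] -/
theorem qf_card_affine (h : (Fin (7 + 7) → Bool) → Bool) (hh : IsDegLeFun 1 h) :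
    #(univ.filter fun x => h x = true) = 0 ∨ #(univ.filter fun x => h x = true) = 8192 ∨ #(univ.filter fun x => h x = true) = 16384 := by
  obtain ⟨z, hz⟩ := td_count_cube (le_refl 1) h hh univ
  simp only [mem_univ, implies_true, true_and, card_univ, Fintype.card_fin, show (7 + 7 + 1 - 1) / 1 = 14 by norm_num] at hz
  have hle : #(univ.filter fun x => h x = true) ≤ 16384 := by
    calc #(univ.filter fun x => h x = true) ≤ #(univ : Finset (Fin (7 + 7) → Bool)) := card_le_univ _
      _ = 16384 := by simp
  omega

/-- **A quadratic with `4096` ones is a 12-flat.** If `q : 𝔽₂⁸ → 𝔽₂` has degree `≤ 2` and exactly `4096` ones, then its set of periods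
`V₀ = {a : q(x ⊕ a) = q(x) ∀x}` is `⊕`-closed of size `4096` and the ones of `q` form a single coset of `V₀`. [this work] -/
theorem qf_flat_of_quadratic (q : (Fin (7 + 7) → Bool) → Bool) (hq : IsDegLeFun 2 q) (h4096 : #(univ.filter fun x => q x = true) = 4096) :
    zeroVec ∈ (univ.filter fun a : Fin (7 + 7) → Bool => ∀ x, q (bxor x a) = q x) ∧
    (∀ a ∈ (univ.filter fun a : Fin (7 + 7) → Bool => ∀ x, q (bxor x a) = q x),
      ∀ b ∈ (univ.filter fun a : Fin (7 + 7) → Bool => ∀ x, q (bxor x a) = q x),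
        bxor a b ∈ (univ.filter fun a : Fin (7 + 7) → Bool => ∀ x, q (bxor x a) = q x)) ∧
    #(univ.filter fun a : Fin (7 + 7) → Bool => ∀ x, q (bxor x a) = q x) = 4096 ∧
    ∀ x₀, q x₀ = true → (univ.filter fun x => q x = true) =
      (univ.filter fun a : Fin (7 + 7) → Bool => ∀ x, q (bxor x a) = q x).image (bxor x₀) := by
  classical
  set V₀ := univ.filter (fun a : Fin (7 + 7) → Bool => ∀ x, q (bxor x a) = q x) with hV₀
  have h0 : zeroVec ∈ V₀ := mem_filter.2 ⟨mem_univ _, fun x => by rw [bxor_zeroVec]⟩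
  have hadd : ∀ a ∈ V₀, ∀ b ∈ V₀, bxor a b ∈ V₀ := by
    intro a ha b hb
    refine mem_filter.2 ⟨mem_univ _, fun x => ?_⟩
    rw [← iw_bxor_assoc, (mem_filter.1 hb).2, (mem_filter.1 ha).2]
  -- weight of a derivative: 0 or 8192
  have hD : ∀ a, #(univ.filter fun x => (q x ^^ q (bxor x a)) = true) = 0 ∨
      #(univ.filter fun x => (q x ^^ q (bxor x a)) = true) = 8192 := by
    intro a
    have haff : IsDegLeFun 1 (fun x => q x ^^ q (bxor x a)) := stub_derivDegree (7 + 7) 1 q a hq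
    have hle : #(univ.filter fun x => (q x ^^ q (bxor x a)) = true) ≤ 8192 := by
      calc #(univ.filter fun x => (q x ^^ q (bxor x a)) = true)
          ≤ #((univ.filter fun x => q x = true) ∪ univ.filter fun x => q (bxor x a) = true) := by
            refine card_le_card fun x hx => ?_
            have h' := (mem_filter.1 hx).2
            rw [mem_union, mem_filter, mem_filter]
            revert h'; cases q x <;> cases q (bxor x a) <;> simp
        _ ≤ #(univ.filter fun x => q x = true) + #(univ.filter fun x => q (bxor x a) = true) := card_union_le _ _
        _ = 4096 + 4096 := by
            rw [h4096]
            congr 1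
            rw [← h4096]
            refine card_nbij' (fun x => bxor x a) (fun x => bxor x a) (fun x hx => ?_) (fun x hx => ?_)
              (fun x _ => by show bxor (bxor x a) a = x; rw [iw_bxor_assoc, BuzetChailloux.bxor_self, bxor_zeroVec])
              (fun x _ => by show bxor (bxor x a) a = x; rw [iw_bxor_assoc, BuzetChailloux.bxor_self, bxor_zeroVec])
            · exact mem_filter.2 ⟨mem_univ _, (mem_filter.1 hx).2⟩
            · refine mem_filter.2 ⟨mem_univ _, ?_⟩
              rw [iw_bxor_assoc, BuzetChailloux.bxor_self, bxor_zeroVec]; exact (mem_filter.1 hx).2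
    rcases qf_card_affine _ haff with h | h | h
    · exact Or.inl h
    · exact Or.inr h
    · omega
  have hmemV : ∀ a, a ∈ V₀ ↔ #(univ.filter fun x => (q x ^^ q (bxor x a)) = true) = 0 := by
    intro a
    rw [card_eq_zero, filter_eq_empty_iff]
    constructor
    · intro ha x _; rw [(mem_filter.1 ha).2 x, Bool.xor_self]; exact Bool.false_ne_true
    · intro h0; refine mem_filter.2 ⟨mem_univ _, fun x => ?_⟩
      have := h0 (mem_univ x); revert this; cases q x <;> cases q (bxor x a) <;> simp
  -- double counting
  have hcount : ∑ a, (#(univ.filter fun x => (q x ^^ q (bxor x a)) = true) : ℕ) = 100663296 := by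
    simp_rw [card_filter]
    rw [sum_comm]
    have inner : ∀ x, ∑ a, (if (q x ^^ q (bxor x a)) = true then 1 else 0 : ℕ) = if q x = true then 12288 else 4096 := by
      intro x
      rw [Fintype.sum_equiv (Equiv.mk (bxor x) (bxor x) (bxor_bxor_cancel_left x) (bxor_bxor_cancel_left x))
        (fun a => if (q x ^^ q (bxor x a)) = true then 1 else 0) (fun y => if (q x ^^ q y) = true then 1 else 0) (fun _ => rfl)]
      rw [sum_boole]
      cases hx : q x
      · simp only [Bool.false_xor, Bool.false_eq_true, if_false]
        exact h4096
      · simp only [Bool.true_xor, if_true, Bool.not_eq_true', Nat.cast_id]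
        have hc := card_filter_add_card_filter_not (s := (univ : Finset (Fin (7 + 7) → Bool))) (fun y => q y = true)
        rw [h4096, card_univ, Fintype.card_fun, Fintype.card_bool, Fintype.card_fin] at hc
        simp only [Nat.reducePow, Nat.reduceAdd] at hc
        have h12288 : #(univ.filter fun y : Fin (7 + 7) → Bool => ¬ q y = true) = 12288 := Nat.add_left_cancel (hc.trans (by norm_num))
        have hc' : (univ.filter fun y : Fin (7 + 7) → Bool => ¬ q y = true) = univ.filter fun y => q y = false :=
          filter_congr fun y _ => by cases q y <;> simp
        rw [← hc']; exact h12288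
    rw [sum_congr rfl fun x _ => inner x, sum_ite, sum_const, sum_const, smul_eq_mul, smul_eq_mul]
    have hc : #(univ.filter fun x : Fin (7 + 7) → Bool => ¬ q x = true) = 12288 := by
      have := card_filter_add_card_filter_not (s := (univ : Finset (Fin (7 + 7) → Bool))) (fun x => q x = true)
      rw [h4096, card_univ, Fintype.card_fun, Fintype.card_bool, Fintype.card_fin] at this
      simp only [Nat.reducePow, Nat.reduceAdd] at this
      exact Nat.add_left_cancel (this.trans (by norm_num))
    rw [h4096, hc]
  have hcount' : ∑ a, (#(univ.filter fun x => (q x ^^ q (bxor x a)) = true) : ℕ) = 8192 * #(univ.filter fun a => a ∉ V₀) := by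
    rw [← sum_filter_add_sum_filter_not univ (fun a => a ∈ V₀)]
    rw [sum_eq_zero fun a ha => (hmemV a).1 (mem_filter.1 ha).2, zero_add]
    rw [sum_congr rfl fun a ha => ((hD a).resolve_left fun h => absurd ((hmemV a).2 h) (mem_filter.1 ha).2), sum_const,
      smul_eq_mul, mul_comm]
  have hcardV : #V₀ = 4096 := by
    have h1 : #(univ.filter fun a : Fin (7 + 7) → Bool => a ∉ V₀) = 12288 := by
      have := hcount.symm.trans hcount'; omega
    have h2 := card_filter_add_card_filter_not (s := (univ : Finset (Fin (7 + 7) → Bool))) (fun a => a ∈ V₀)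
    rw [h1, filter_mem_eq_inter, univ_inter, card_univ, Fintype.card_fun, Fintype.card_bool, Fintype.card_fin] at h2
    simp only [Nat.reducePow, Nat.reduceAdd] at h2
    omega
  refine ⟨h0, hadd, hcardV, fun x₀ hx₀ => ?_⟩
  symm
  apply eq_of_subset_of_card_le
  · intro y hy
    obtain ⟨a, ha, rfl⟩ := mem_image.1 hy
    exact mem_filter.2 ⟨mem_univ _, by rw [(mem_filter.1 ha).2 x₀]; exact hx₀⟩
  · rw [h4096, card_image_of_injective _ fun a b hab => by simpa only [bxor_bxor_cancel_left] using congrArg (bxor x₀) hab,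
      hcardV]


end Summit.QuantumAdvantage.QuantumAdvantage.Theorems.CubicForrelation.NearExactIsExact

end
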